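import Literature.NumberTheory.PAdicHodge.LubinTateAinfTorsionLiftAction
import Literature.NumberTheory.PAdicHodge.LubinTateAinfTorsionLiftTilt
import Literature.NumberTheory.PAdicHodge.LubinTateDivisionTowerCoeff
import Literature.NumberTheory.PAdicHodge.AinfRamifiedComplete
import HarnessLib

/-!
# The Lubin–Tate period `t_π = λ_f(ι_𝒪 x_t) ∈ Fil¹ B_dR⁺ ∖ Fil²` and its `Γ_F`-law `σ t_π = χ_π(σ)·t_π`

Topic `Literature/NumberTheory/PAdicHodge`; the Lubin–Tate analogue of `AinfRamifiedOmegaPeriod` (the ω-period of a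
Weierstrass formal group). Fix a `p`-adic field `F`, an Eisenstein root datum `D` (`𝒪_D = ℤ_p[ϖ] ⊆ 𝒪_F`, the coefficient
ring `CoeffDisc D` of the ramified ring `A_inf(𝒪)`), a uniformizer `π ∈ 𝒪_F` with `π = ϖ` in `F`, and the Lubin–Tate
polynomial `f = πX + X^q`, `q = #k_F` (`P = ϖX + X^q` over `𝒪_D`). For a division tower `t` of `P` in `𝔪_{ℂ_F}`
(`P(t_{n+1}) = t_n`, `t_0 = 0`) Fontaine's element `x_t ∈ ker θ_𝒪 ⊂ A_inf(𝒪)` (`LubinTateAinfTorsionLift`) maps to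
`ι_𝒪 x_t ∈ Fil¹ B_dR⁺` and

* `ltLiftFil t := ι_𝒪(x_t) ∈ Fil¹ B_dR⁺`; `gal_ltLiftFil : σ ι(x_t) = ι(x_{σt})`; ★ `ltSMul_ltLiftFil : ι(x_{[a]t}) = [a]_P^F(ι x_t)`
  (`𝒪_D`-linearity of Fontaine's element, `LubinTateAinfTorsionLiftAction.ltSMul_ltTorsionLift`, transported to `B_dR⁺` by
  `AinfRamXiTop.toBdR_evalPt_of_symm`);
* `ltLogSeries := λ_f ∈ F⟦X⟧` over the discrete coefficient field (tree `ltLog`), `subst_map_hom_ltLogSeries : λ ∘ [a]_P = a·λ`;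
* **`ltPeriod t := λ_f(ι_𝒪 x_t) ∈ B_dR⁺`** — `ltPeriod_mem_filOne`, `ltPeriod_sub_ltLiftFil_mem_sq : λ(ι x_t) ≡ ι x_t (mod Fil²)`,
  ★ `ltPeriod_not_mem_sq : t_π ∉ Fil²` (`q ≥ 3`, `t₁ ≠ 0`; the tilt test `ω² ∤ x_t` of `LubinTateAinfTorsionLiftTilt` and
  `A_inf(𝒪) ∩ Fil² = ω²`), `gal_ltPeriod_galSeq : σ λ(ι x_t) = λ(ι x_{σt})`, ★ `ltPeriod_ltSMul : λ(ι x_{[a]t}) = a · λ(ι x_t)`,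
  ★★ `gal_ltPeriod : σ(t_π) = a · t_π` whenever `σ tₙ = [a]_P(tₙ)` for all `n`;
* the `π`-division tower of `F_f` (`LubinTateDivisionTowerCBall.ltDivTower`): **`lubinTatePeriod hθ hπ hπD hpq : B_dR⁺(F)`**,
  ★★ `gal_lubinTatePeriod : σ(t_π) = χ_π(σ)·t_π` for every `σ` whose Lubin–Tate character value lies in `𝒪_D`
  (`toInt a = χ_π(σ)`; for `F` totally ramified `𝒪_D = 𝒪_F` and this is every `σ ∈ Γ_F`), `lubinTatePeriod_mem_filOne`,
  ★ `lubinTatePeriod_not_mem_sq` (`q ≥ 3`).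

This is Colmez's "période de Lubin–Tate" `t_π ∈ B_dR⁺` with `σ t_π = χ_π(σ) t_π`, `t_π ∈ Fil¹ ∖ Fil²` (Colmez 1993 §I.2,
Fontaine Astérisque 223 Exp. II §1.5 for `t = t_p`), built here from the tree's ramified `A_inf(𝒪)`. No named facts, no
`sorry`. Langlands (GL₁ / de Rham characters): the source of the Hodge–Tate period of `χ_π` at the identity embedding.

## References
* P. Colmez, *Périodes des variétés abéliennes à multiplication complexe*, Ann. of Math. 138 (1993), §I.2. [Colmez1993]
* J.-M. Fontaine, *Le corps des périodes p-adiques*, Astérisque 223 (1994), Exp. II §1.5. [FontaineAsterisque223III]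
* J. Lubin, J. Tate, *Formal complex multiplication in local fields*, Ann. of Math. 81 (1965), §1. [LubinTate1965]
* E. de Shalit, *Iwasawa theory of elliptic curves with complex multiplication* (1987), Ch. I §1.2–1.3. [deShalit1987]
-/

noncomputable section

open Ideal Field WittVector MvPowerSeries ValuativeRel

namespace Literature.NumberTheory.PAdicHodge

open Literature.NumberTheory.GaloisRepresentations
open Literature.NumberTheory.GaloisRepresentations.IsNonarchimedeanLocalField
open Literature.NumberTheory.GaloisRepresentations.LubinTate

variable {F : Type} [Field F] [ValuativeRel F] [TopologicalSpace F] [IsNonarchimedeanLocalField F] [CharZero F]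
  {p : ℕ} [Fact p.Prime] {hp : valuation F p < 1} {D : EisensteinRoot F p hp}
  [Fact (¬ IsUnit (p : integerC F))] [IsAdicComplete (Ideal.span {(p : integerC F)}) (integerC F)]

/-! ## §0 `f(x) ≡ x (mod Fil²)` for `F`-series with `f(0) = 0`, `f'(0) = 1` -/

namespace FieldCoeff

variable {hθ : Function.Surjective (fontaineTheta (integerC F) p)}

/-- **`f(x) ≡ x (mod Fil²)`** for `f ∈ F⟦T⟧` with `f(0) = 0`, `f'(0) = 1` and `x ∈ Fil¹ B_dR⁺` (e.g. `f = λ_f`, the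
Lubin–Tate logarithm). [cite: FontaineAsterisque223III, Exp. II §1.5.4] -/
theorem evalPt₁_sub_self_mem_sq (f : PowerSeries (FieldCoeff hp hθ)) (hf0 : PowerSeries.constantCoeff f = 0)
    (hf1 : PowerSeries.coeff 1 f = 1) (x : (BdRPlusTop.filOne F p).toIdeal) :
    (evalPt₁ (BdRPlusTop.filOne F p) f hf0 x : BdRPlusTop F p) - x ∈ (WithIdeal.i ^ 2 : Ideal (BdRPlusTop F p)) := by
  set f₂ : PowerSeries (FieldCoeff hp hθ) := PowerSeries.mk (fun n => PowerSeries.coeff (n + 1)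
      (PowerSeries.mk fun m => PowerSeries.coeff (m + 1) f)) with hf₂
  -- `f = T·(T·f₂ + 1)` (`f(0) = 0`, `f'(0) = 1`)
  have hdec : f = PowerSeries.X * (PowerSeries.X * f₂ + 1) := by
    have h1 := PowerSeries.eq_X_mul_shift_add_const f
    have h2 := PowerSeries.eq_X_mul_shift_add_const (PowerSeries.mk fun m => PowerSeries.coeff (m + 1) f)
    have hc : PowerSeries.constantCoeff (PowerSeries.mk fun m => PowerSeries.coeff (m + 1) f) = 1 := by
      rw [← PowerSeries.coeff_zero_eq_constantCoeff_apply, PowerSeries.coeff_mk, zero_add, hf1]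
    rw [hc, map_one] at h2
    rw [hf0, map_zero, add_zero, h2] at h1
    exact h1
  have hX : aeval ((BdRPlusTop.filOne F p).hasEval fun _ : Unit => x) (PowerSeries.X : PowerSeries (FieldCoeff hp hθ)) =
      (x : BdRPlusTop F p) :=
    aeval_X' ((BdRPlusTop.filOne F p).hasEval fun _ : Unit => x) ()
  have hval : (evalPt₁ (BdRPlusTop.filOne F p) f hf0 x : BdRPlusTop F p) =
      (x : BdRPlusTop F p) * ((x : BdRPlusTop F p) * aeval ((BdRPlusTop.filOne F p).hasEval fun _ : Unit => x) f₂ + 1) := by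
    change aeval ((BdRPlusTop.filOne F p).hasEval fun _ : Unit => x) f = _
    conv_lhs => rw [hdec]
    rw [map_mul, map_add, map_mul, map_one, hX]
  rw [hval, show (x : BdRPlusTop F p) * ((x : BdRPlusTop F p) * aeval ((BdRPlusTop.filOne F p).hasEval fun _ : Unit => x) f₂ + 1)
      - x = (x : BdRPlusTop F p) * x * aeval ((BdRPlusTop.filOne F p).hasEval fun _ : Unit => x) f₂ by ring, pow_two]
  exact Ideal.mul_mem_right _ _ (Ideal.mul_mem_mul x.2 x.2)

/-- **Scalars come out of evaluation: `(c·f)(x) = c·f(x)`.** [cite: CasselsFrohlichANT1967, Ch. VI §3.2] -/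
theorem coe_evalPt₁_C_mul (c : FieldCoeff hp hθ) (f : PowerSeries (FieldCoeff hp hθ)) (hf : PowerSeries.constantCoeff f = 0)
    (hcf : PowerSeries.constantCoeff (PowerSeries.C c * f) = 0) (x : (BdRPlusTop.filOne F p).toIdeal) :
    (evalPt₁ (BdRPlusTop.filOne F p) (PowerSeries.C c * f) hcf x : BdRPlusTop F p) =
      algebraMap (FieldCoeff hp hθ) (BdRPlusTop F p) c * (evalPt₁ (BdRPlusTop.filOne F p) f hf x : BdRPlusTop F p) := by
  change aeval ((BdRPlusTop.filOne F p).hasEval fun _ : Unit => x) (PowerSeries.C c * f) =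
    _ * aeval ((BdRPlusTop.filOne F p).hasEval fun _ : Unit => x) f
  rw [map_mul, PowerSeries.C_eq_algebraMap, AlgHom.commutes]

end FieldCoeff

namespace AinfRamTop

variable {hθ : Function.Surjective (fontaineTheta (integerC F) p)} (hpq : p ∣ residueFieldCard F)

/-! ## §1 `ι_𝒪(x_t) ∈ Fil¹ B_dR⁺` -/

/-- `θ_𝒪(x_t) = 0` in `A_inf(𝒪)` for a division tower with `t₀ = 0`. [cite: FontaineAsterisque223III, Exp. II §1.2.2] -/
theorem theta_symm_ltTorsionLift {t : ℕ → (maxNilIdealC F).toIdeal} (ht0 : (t 0 : CBall F) = 0)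
    (htp : ∀ n, ltStepC (EisensteinRoot.CoeffDisc.of D (AdjoinRoot.root D.poly)) (residueFieldCard_ne_zero F) (t (n + 1)) = t n) :
    AinfRam.theta D ((of D).symm (ltTorsionLift (EisensteinRoot.CoeffDisc.of D (AdjoinRoot.root D.poly))
      (residueFieldCard_ne_zero F) hpq (k := D.e) algebraMap_varpiDisc_pow_mem_ideal hθ t htp)) = 0 := by
  have h := theta_ltTorsionLift (hθ := hθ) hpq (k := D.e) algebraMap_varpiDisc_pow_mem_ideal htp
  have h' := congrArg (fun z : CBall F => (z : CompletedAlgClosure F)) h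
  simp only [ht0, ZeroMemClass.coe_zero] at h'
  exact Subtype.ext h'

/-- `x_t ∈ ω A_inf(𝒪)` (`ker θ_𝒪 = (ω)`). [cite: FarguesFontaine2018, §2.2 (Cor. 2.2.8)] -/
theorem symm_ltTorsionLift_mem_span_omega {t : ℕ → (maxNilIdealC F).toIdeal} (ht0 : (t 0 : CBall F) = 0)
    (htp : ∀ n, ltStepC (EisensteinRoot.CoeffDisc.of D (AdjoinRoot.root D.poly)) (residueFieldCard_ne_zero F) (t (n + 1)) = t n) :
    (of D).symm (ltTorsionLift (EisensteinRoot.CoeffDisc.of D (AdjoinRoot.root D.poly)) (residueFieldCard_ne_zero F) hpq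
      (k := D.e) algebraMap_varpiDisc_pow_mem_ideal hθ t htp) ∈ Ideal.span {AinfRam.omega D} :=
  Ideal.mem_span_singleton.2 ((AinfRam.theta_eq_zero_iff_omega_dvd D _).1 (theta_symm_ltTorsionLift hpq ht0 htp))

/-- `ι_𝒪(x_t) ∈ Fil¹ B_dR⁺ = (ξ_dR)`. [cite: FontaineAsterisque223III, Exp. II §1.5.2] -/
theorem toBdR_ltTorsionLift_mem_filOne {t : ℕ → (maxNilIdealC F).toIdeal} (ht0 : (t 0 : CBall F) = 0)
    (htp : ∀ n, ltStepC (EisensteinRoot.CoeffDisc.of D (AdjoinRoot.root D.poly)) (residueFieldCard_ne_zero F) (t (n + 1)) = t n) :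
    BdRPlusTop.of F p (AinfRam.toBdR D hθ ((of D).symm (ltTorsionLift (EisensteinRoot.CoeffDisc.of D (AdjoinRoot.root D.poly))
      (residueFieldCard_ne_zero F) hpq (k := D.e) algebraMap_varpiDisc_pow_mem_ideal hθ t htp))) ∈
      (BdRPlusTop.filOne F p).toIdeal := by
  rw [BdRPlusTop.mem_filOne_iff]
  exact AinfRam.toBdR_mem_span_xiBdR D hθ (theta_symm_ltTorsionLift hpq ht0 htp)

/-- **`ι_𝒪(x_t)` as a point of `Fil¹ B_dR⁺`.** [cite: FontaineAsterisque223III, Exp. II §1.5.2] [cite: Colmez1993, §I.2] -/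
def ltLiftFil (hθ : Function.Surjective (fontaineTheta (integerC F) p)) (hpq : p ∣ residueFieldCard F)
    (t : ℕ → (maxNilIdealC F).toIdeal) (ht0 : (t 0 : CBall F) = 0)
    (htp : ∀ n, ltStepC (EisensteinRoot.CoeffDisc.of D (AdjoinRoot.root D.poly)) (residueFieldCard_ne_zero F) (t (n + 1)) = t n) :
    (BdRPlusTop.filOne F p).toIdeal :=
  ⟨BdRPlusTop.of F p (AinfRam.toBdR D hθ ((of D).symm (ltTorsionLift (EisensteinRoot.CoeffDisc.of D (AdjoinRoot.root D.poly))
      (residueFieldCard_ne_zero F) hpq (k := D.e) algebraMap_varpiDisc_pow_mem_ideal hθ t htp))),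
    toBdR_ltTorsionLift_mem_filOne hpq ht0 htp⟩

/-- Unfolding `ltLiftFil`. [cite: FontaineAsterisque223III, Exp. II §1.5.2] -/
theorem coe_ltLiftFil {t : ℕ → (maxNilIdealC F).toIdeal} (ht0 : (t 0 : CBall F) = 0)
    (htp : ∀ n, ltStepC (EisensteinRoot.CoeffDisc.of D (AdjoinRoot.root D.poly)) (residueFieldCard_ne_zero F) (t (n + 1)) = t n) :
    (ltLiftFil hθ hpq t ht0 htp : BdRPlusTop F p) =
      BdRPlusTop.of F p (AinfRam.toBdR D hθ ((of D).symm (ltTorsionLift (EisensteinRoot.CoeffDisc.of D (AdjoinRoot.root D.poly))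
        (residueFieldCard_ne_zero F) hpq (k := D.e) algebraMap_varpiDisc_pow_mem_ideal hθ t htp))) :=
  rfl

/-- Congruence of `ltLiftFil` in the tower. [cite: FontaineAsterisque223III, Exp. II §1.5.2] -/
theorem ltLiftFil_congr {t t' : ℕ → (maxNilIdealC F).toIdeal} (h : t = t') (ht0 : (t 0 : CBall F) = 0)
    (htp : ∀ n, ltStepC (EisensteinRoot.CoeffDisc.of D (AdjoinRoot.root D.poly)) (residueFieldCard_ne_zero F) (t (n + 1)) = t n)
    (ht0' : (t' 0 : CBall F) = 0)
    (htp' : ∀ n, ltStepC (EisensteinRoot.CoeffDisc.of D (AdjoinRoot.root D.poly)) (residueFieldCard_ne_zero F) (t' (n + 1)) = t' n) :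
    ltLiftFil hθ hpq t ht0 htp = ltLiftFil hθ hpq t' ht0' htp' := by
  subst h; rfl

/-- **`ι_𝒪(x_t) ∉ Fil² B_dR⁺`** (`q ≥ 3`, `t₁ ≠ 0`): `ω² ∤ x_t` (tilt test) and `ι_𝒪⁻¹(Fil²) = ω² A_inf(𝒪)`.
[cite: Colmez1993, §I.2] [cite: FontaineAsterisque223III, Exp. II §1.5.3] -/
theorem ltLiftFil_not_mem_sq (hq3 : 3 ≤ residueFieldCard F) {t : ℕ → (maxNilIdealC F).toIdeal} (ht0 : (t 0 : CBall F) = 0)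
    (htp : ∀ n, ltStepC (EisensteinRoot.CoeffDisc.of D (AdjoinRoot.root D.poly)) (residueFieldCard_ne_zero F) (t (n + 1)) = t n)
    (ht1 : (t 1 : CBall F) ≠ 0) :
    (ltLiftFil hθ hpq t ht0 htp : BdRPlusTop F p) ∉ (WithIdeal.i ^ 2 : Ideal (BdRPlusTop F p)) := by
  intro hsq
  rw [coe_ltLiftFil, BdRPlusTop.ideal_eq, Ideal.span_singleton_pow, Ideal.mem_span_singleton'] at hsq
  obtain ⟨w, hw⟩ := hsq
  apply ltTorsionLift_not_dvd_omega_sq (hθ := hθ) (residueFieldCard_ne_zero F) hpq hq3 htp ht0 ht1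
  refine AinfRam.omega_pow_dvd_of_toBdR_mem_span_pow D hθ 2 (Ideal.mem_span_singleton'.2 ⟨(BdRPlusTop.of F p).symm w, ?_⟩)
  have h := congrArg (BdRPlusTop.of F p).symm hw
  rw [map_mul, map_pow, RingEquiv.symm_apply_apply, RingEquiv.symm_apply_apply] at h
  exact h

/-- **`σ(ι_𝒪 x_t) = ι_𝒪(x_{σt})`.** [cite: FontaineAsterisque223III, Exp. II §1.5] [cite: Colmez1993, §I.2] -/
theorem gal_ltLiftFil (σ : absoluteGaloisGroup F) {t : ℕ → (maxNilIdealC F).toIdeal} (ht0 : (t 0 : CBall F) = 0)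
    (htp : ∀ n, ltStepC (EisensteinRoot.CoeffDisc.of D (AdjoinRoot.root D.poly)) (residueFieldCard_ne_zero F) (t (n + 1)) = t n) :
    BdRPlusTop.gal F p σ (ltLiftFil hθ hpq t ht0 htp : BdRPlusTop F p) =
      (ltLiftFil hθ hpq (AinfTop.galSeq F σ t) (AinfTop.coe_galSeq_zero σ ht0) (ltStepC_galSeq hθ σ htp) : BdRPlusTop F p) := by
  rw [coe_ltLiftFil, coe_ltLiftFil, BdRPlusTop.gal_of, AinfRam.galBdRPlus_toBdR,
    ← gal_ltTorsionLift hpq (k := D.e) algebraMap_varpiDisc_pow_mem_ideal σ htp]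
  rfl

/-! ## §2 `𝒪_D`-linearity of `ι_𝒪(x_t)`: `ι(x_{[a]t}) = [a]_P(ι x_t)` in `B_dR⁺` -/

section Action

variable (hA : IsLTRing (EisensteinRoot.CoeffDisc.of D (AdjoinRoot.root D.poly)) (residueFieldCard F))
  (hf : IsLTSeries (EisensteinRoot.CoeffDisc.of D (AdjoinRoot.root D.poly)) (residueFieldCard F)
    (ltSeries (EisensteinRoot.CoeffDisc.of D (AdjoinRoot.root D.poly)) (residueFieldCard F)))

/-- The constant term of `[a]_P` over `F` vanishes. [cite: LubinTate1965, §1 Lemma 1] -/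
theorem constantCoeff_map_hom_toFieldCoeff (a : EisensteinRoot.CoeffDisc D) :
    PowerSeries.constantCoeff ((hom hA hf hf a).map (EisensteinRoot.CoeffDisc.toFieldCoeff D hθ)) = 0 := by
  rw [← PowerSeries.coeff_zero_eq_constantCoeff_apply, PowerSeries.coeff_map, PowerSeries.coeff_zero_eq_constantCoeff_apply,
    constantCoeff_hom, map_zero]

omit [Fact (¬ IsUnit (p : integerC F))] [IsAdicComplete (Ideal.span {(p : integerC F)}) (integerC F)] in
/-- The tower `([a]_P tₙ)ₙ` again starts at `0`. [cite: LubinTate1965, §1 Lemma 1] -/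
theorem coe_ltSMul_apply_zero (a : EisensteinRoot.CoeffDisc D) {t : ℕ → (maxNilIdealC F).toIdeal} (ht0 : (t 0 : CBall F) = 0) :
    (((fun n => ltSMul (maxNilIdealC F) hA hf a (t n)) 0 : (maxNilIdealC F).toIdeal) : CBall F) = 0 := by
  show ((ltSMul (maxNilIdealC F) hA hf a (t 0) : (maxNilIdealC F).toIdeal) : CBall F) = 0
  rw [show t 0 = 0 from Subtype.ext ht0, ltSMul_zero]
  rfl

/-- ★ **`ι_𝒪(x_{[a]t}) = [a]_P(ι_𝒪 x_t)`** for `a ∈ 𝒪_D`: Fontaine's element is `𝒪_D`-linear (`[a]_P x_t = x_{[a]t}` in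
`A_inf(𝒪)`) and `ι_𝒪` commutes with evaluation of `𝒪_D`-series at points of `ker θ_𝒪`.
[cite: Colmez1993, §I.2] [cite: FontaineAsterisque223III, Exp. II §1.5.2] -/
theorem ltSMul_ltLiftFil (a : EisensteinRoot.CoeffDisc D) {t : ℕ → (maxNilIdealC F).toIdeal} (ht0 : (t 0 : CBall F) = 0)
    (htp : ∀ n, ltStepC (EisensteinRoot.CoeffDisc.of D (AdjoinRoot.root D.poly)) (residueFieldCard_ne_zero F) (t (n + 1)) = t n) :
    (ltLiftFil hθ hpq (fun n => ltSMul (maxNilIdealC F) hA hf a (t n)) (coe_ltSMul_apply_zero hA hf a ht0)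
        (ltStepC_ltSMul_succ hA hf a htp) : BdRPlusTop F p) =
      (evalPt₁ (BdRPlusTop.filOne F p) ((hom hA hf hf a).map (EisensteinRoot.CoeffDisc.toFieldCoeff D hθ))
        (constantCoeff_map_hom_toFieldCoeff (hθ := hθ) hA hf a) (ltLiftFil hθ hpq t ht0 htp) : BdRPlusTop F p) := by
  rw [coe_ltLiftFil, ← ltSMul_ltTorsionLift hA hf hpq (k := D.e) algebraMap_varpiDisc_pow_mem_ideal a htp]
  unfold ltSMul evalPt₁
  exact AinfRamXiTop.toBdR_evalPt_of_symm (ι := Unit) (hom hA hf hf a) (constantCoeff_hom hA hf hf a)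
    (constantCoeff_map_hom_toFieldCoeff (hθ := hθ) hA hf a) _
    (fun _ => symm_ltTorsionLift_mem_span_omega hpq ht0 htp) _ (fun _ => rfl)

end Action

/-! ## §3 The Lubin–Tate logarithm over the discrete coefficient field and the period `λ_f(ι_𝒪 x_t)` -/

section Period

variable {π : 𝒪[F]} (hπ : (valuation F).IsUniformizer (π : F))

variable (hθ) in
/-- **The Lubin–Tate logarithm `λ_f ∈ F⟦X⟧`** (`f = πX + X^q`) over the discrete coefficient field of `B_dR⁺`-evaluation.
[cite: LubinTate1965, §1 Lemma 1] [cite: deShalit1987, Ch. I §1.2] -/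
def ltLogSeries : PowerSeries (FieldCoeff hp hθ) := (ltLog hπ).map (FieldCoeff.of hp hθ).toRingHom

omit [CharZero F] in
/-- `λ(0) = 0`. [cite: LubinTate1965, §1 Lemma 1] -/
theorem constantCoeff_ltLogSeries : PowerSeries.constantCoeff (ltLogSeries (hp := hp) hθ hπ) = 0 := by
  rw [ltLogSeries, ← PowerSeries.coeff_zero_eq_constantCoeff_apply, PowerSeries.coeff_map,
    PowerSeries.coeff_zero_eq_constantCoeff_apply, constantCoeff_ltLog, map_zero]

omit [CharZero F] in
/-- `λ'(0) = 1`. [cite: LubinTate1965, §1 Lemma 1] -/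
theorem coeff_one_ltLogSeries : PowerSeries.coeff 1 (ltLogSeries (hp := hp) hθ hπ) = 1 := by
  rw [ltLogSeries, PowerSeries.coeff_map, coeff_one_ltLog, map_one]

/-- **The Lubin–Tate period `λ_f(ι_𝒪 x_t) ∈ B_dR⁺`** of a division tower `t` of `P = ϖX + X^q` (`t₀ = 0`): the `ξ`-adically
convergent evaluation of `λ_f ∈ F⟦X⟧` at `ι_𝒪(x_t) ∈ Fil¹`. [cite: Colmez1993, §I.2] [cite: FontaineAsterisque223III, Exp. II §1.5.4] -/
def ltPeriod (hθ : Function.Surjective (fontaineTheta (integerC F) p)) (hπ : (valuation F).IsUniformizer (π : F))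
    (hpq : p ∣ residueFieldCard F) (t : ℕ → (maxNilIdealC F).toIdeal) (ht0 : (t 0 : CBall F) = 0)
    (htp : ∀ n, ltStepC (EisensteinRoot.CoeffDisc.of D (AdjoinRoot.root D.poly)) (residueFieldCard_ne_zero F) (t (n + 1)) = t n) :
    BdRPlusTop F p :=
  (evalPt₁ (BdRPlusTop.filOne F p) (ltLogSeries (hp := hp) hθ hπ) (constantCoeff_ltLogSeries hπ) (ltLiftFil hθ hpq t ht0 htp) :
    BdRPlusTop F p)

/-- `λ(ι x_t) ∈ Fil¹ B_dR⁺`. [cite: Colmez1993, §I.2] -/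
theorem ltPeriod_mem_filOne {t : ℕ → (maxNilIdealC F).toIdeal} (ht0 : (t 0 : CBall F) = 0)
    (htp : ∀ n, ltStepC (EisensteinRoot.CoeffDisc.of D (AdjoinRoot.root D.poly)) (residueFieldCard_ne_zero F) (t (n + 1)) = t n) :
    ltPeriod hθ hπ hpq t ht0 htp ∈ (BdRPlusTop.filOne F p).toIdeal :=
  (evalPt₁ (BdRPlusTop.filOne F p) (ltLogSeries (hp := hp) hθ hπ) (constantCoeff_ltLogSeries hπ) (ltLiftFil hθ hpq t ht0 htp)).2

/-- **`λ(ι x_t) ≡ ι x_t (mod Fil²)`** (`λ ≡ X mod X²`). [cite: FontaineAsterisque223III, Exp. II §1.5.4] [cite: Colmez1993, §I.2] -/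
theorem ltPeriod_sub_ltLiftFil_mem_sq {t : ℕ → (maxNilIdealC F).toIdeal} (ht0 : (t 0 : CBall F) = 0)
    (htp : ∀ n, ltStepC (EisensteinRoot.CoeffDisc.of D (AdjoinRoot.root D.poly)) (residueFieldCard_ne_zero F) (t (n + 1)) = t n) :
    ltPeriod hθ hπ hpq t ht0 htp - (ltLiftFil hθ hpq t ht0 htp : BdRPlusTop F p) ∈ (WithIdeal.i ^ 2 : Ideal (BdRPlusTop F p)) :=
  FieldCoeff.evalPt₁_sub_self_mem_sq _ _ (coeff_one_ltLogSeries hπ) _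

/-- ★ **`λ_f(ι_𝒪 x_t) ∉ Fil² B_dR⁺`** for `q ≥ 3` and `t₁ ≠ 0`: the Lubin–Tate period generates `gr¹ B_dR ≅ ℂ_F(1)`-wise a
nonzero line (its Hodge–Tate component is nonzero). [cite: Colmez1993, §I.2] [cite: Tate1967, §3.3] -/
theorem ltPeriod_not_mem_sq (hq3 : 3 ≤ residueFieldCard F) {t : ℕ → (maxNilIdealC F).toIdeal} (ht0 : (t 0 : CBall F) = 0)
    (htp : ∀ n, ltStepC (EisensteinRoot.CoeffDisc.of D (AdjoinRoot.root D.poly)) (residueFieldCard_ne_zero F) (t (n + 1)) = t n)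
    (ht1 : (t 1 : CBall F) ≠ 0) :
    ltPeriod hθ hπ hpq t ht0 htp ∉ (WithIdeal.i ^ 2 : Ideal (BdRPlusTop F p)) := by
  intro h
  apply ltLiftFil_not_mem_sq hpq hq3 ht0 htp ht1 (hθ := hθ)
  have h2 := sub_mem h (ltPeriod_sub_ltLiftFil_mem_sq hpq hπ ht0 htp (hθ := hθ))
  rwa [sub_sub_cancel] at h2

/-- **`σ(λ(ι x_t)) = λ(ι x_{σt})`** (`λ ∈ F⟦X⟧` has `Γ_F`-fixed coefficients). [cite: FontaineAsterisque223III, Exp. II §1.5.4] -/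
theorem gal_ltPeriod_galSeq (σ : absoluteGaloisGroup F) {t : ℕ → (maxNilIdealC F).toIdeal} (ht0 : (t 0 : CBall F) = 0)
    (htp : ∀ n, ltStepC (EisensteinRoot.CoeffDisc.of D (AdjoinRoot.root D.poly)) (residueFieldCard_ne_zero F) (t (n + 1)) = t n) :
    BdRPlusTop.gal F p σ (ltPeriod hθ hπ hpq t ht0 htp) =
      ltPeriod hθ hπ hpq (AinfTop.galSeq F σ t) (AinfTop.coe_galSeq_zero σ ht0) (ltStepC_galSeq hθ σ htp) := by
  rw [ltPeriod, ltPeriod, FieldCoeff.gal_evalPt₁]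
  congr 2
  exact Subtype.ext (gal_ltLiftFil hpq σ ht0 htp)

/-- Congruence of `ltPeriod` in the tower. [cite: Colmez1993, §I.2] -/
theorem ltPeriod_congr {t t' : ℕ → (maxNilIdealC F).toIdeal} (h : t = t') (ht0 : (t 0 : CBall F) = 0)
    (htp : ∀ n, ltStepC (EisensteinRoot.CoeffDisc.of D (AdjoinRoot.root D.poly)) (residueFieldCard_ne_zero F) (t (n + 1)) = t n)
    (ht0' : (t' 0 : CBall F) = 0)
    (htp' : ∀ n, ltStepC (EisensteinRoot.CoeffDisc.of D (AdjoinRoot.root D.poly)) (residueFieldCard_ne_zero F) (t' (n + 1)) = t' n) :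
    ltPeriod hθ hπ hpq t ht0 htp = ltPeriod hθ hπ hpq t' ht0' htp' := by
  subst h; rfl

variable (hπD : (π : F) = D.root)
  (hA : IsLTRing (EisensteinRoot.CoeffDisc.of D (AdjoinRoot.root D.poly)) (residueFieldCard F))
  (hf : IsLTSeries (EisensteinRoot.CoeffDisc.of D (AdjoinRoot.root D.poly)) (residueFieldCard F)
    (ltSeries (EisensteinRoot.CoeffDisc.of D (AdjoinRoot.root D.poly)) (residueFieldCard F)))

include hπD in
/-- **`λ_f ∘ [a]_P = a · λ_f`** over the discrete coefficient field (`a ∈ 𝒪_D ⊆ 𝒪_F`; tree `subst_hom_ltLog`).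
[cite: LubinTate1965, §1 Thm. 1 (9)] -/
theorem subst_map_hom_ltLogSeries (a : EisensteinRoot.CoeffDisc D) :
    PowerSeries.subst ((hom hA hf hf a).map (EisensteinRoot.CoeffDisc.toFieldCoeff D hθ)) (ltLogSeries hθ hπ) =
      PowerSeries.C (EisensteinRoot.CoeffDisc.toFieldCoeff D hθ a) * ltLogSeries hθ hπ := by
  have hcomp : (algebraMap 𝒪[F] F).comp (EisensteinRoot.CoeffDisc.toInt D) = EisensteinRoot.CoeffDisc.toF D :=
    RingHom.ext fun _ => rfl
  have h0 : PowerSeries.constantCoeff ((hom hA hf hf a).map (EisensteinRoot.CoeffDisc.toF D)) = 0 := by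
    rw [← PowerSeries.coeff_zero_eq_constantCoeff_apply, PowerSeries.coeff_map, PowerSeries.coeff_zero_eq_constantCoeff_apply,
      constantCoeff_hom, map_zero]
  have h := congrArg (PowerSeries.map (FieldCoeff.of hp hθ).toRingHom)
    (EisensteinRoot.subst_map_hom_ltLog D hπ hπD hA hf a)
  rw [hcomp, map_subst₁F _ h0, map_mul, PowerSeries.map_C, ← RingHom.comp_apply (PowerSeries.map _) (PowerSeries.map _),
    ← PowerSeries.map_comp] at h
  exact h

include hπD in
/-- ★ **`λ_f(ι_𝒪 x_{[a]t}) = a · λ_f(ι_𝒪 x_t)`** for `a ∈ 𝒪_D`: the Lubin–Tate period is `𝒪_D`-linear in the tower.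
[cite: Colmez1993, §I.2] [cite: LubinTate1965, §1 Thm. 1 (9)] -/
theorem ltPeriod_ltSMul (a : EisensteinRoot.CoeffDisc D) {t : ℕ → (maxNilIdealC F).toIdeal} (ht0 : (t 0 : CBall F) = 0)
    (htp : ∀ n, ltStepC (EisensteinRoot.CoeffDisc.of D (AdjoinRoot.root D.poly)) (residueFieldCard_ne_zero F) (t (n + 1)) = t n) :
    ltPeriod hθ hπ hpq (fun n => ltSMul (maxNilIdealC F) hA hf a (t n)) (coe_ltSMul_apply_zero hA hf a ht0)
        (ltStepC_ltSMul_succ hA hf a htp) =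
      algebraMap (FieldCoeff hp hθ) (BdRPlusTop F p) (EisensteinRoot.CoeffDisc.toFieldCoeff D hθ a) * ltPeriod hθ hπ hpq t ht0 htp := by
  have hcf : PowerSeries.constantCoeff (PowerSeries.C (EisensteinRoot.CoeffDisc.toFieldCoeff D hθ a) * ltLogSeries hθ hπ) = 0 := by
    rw [map_mul, constantCoeff_ltLogSeries, mul_zero]
  have hsub := subst_map_hom_ltLogSeries hπ hπD hA hf a (hθ := hθ)
  have hhg : PowerSeries.constantCoeff (PowerSeries.subst ((hom hA hf hf a).map (EisensteinRoot.CoeffDisc.toFieldCoeff D hθ))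
      (ltLogSeries hθ hπ)) = 0 := by rw [hsub]; exact hcf
  rw [ltPeriod, ltPeriod, ← FieldCoeff.coe_evalPt₁_C_mul _ _ (constantCoeff_ltLogSeries hπ) hcf]
  have e1 : (evalPt₁ (BdRPlusTop.filOne F p) _ hcf (ltLiftFil hθ hpq t ht0 htp) : BdRPlusTop F p) =
      (evalPt₁ (BdRPlusTop.filOne F p) _ hhg (ltLiftFil hθ hpq t ht0 htp) : BdRPlusTop F p) :=
    congrArg Subtype.val (evalPt_congr (BdRPlusTop.filOne F p) hsub.symm hcf hhg _)
  rw [e1, evalPt₁, evalPt₁, evalPt₁_subst (BdRPlusTop.filOne F p) _ (constantCoeff_map_hom_toFieldCoeff (hθ := hθ) hA hf a) _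
    (constantCoeff_ltLogSeries hπ) hhg, evalPt₁]
  congr 2
  funext
  exact Subtype.ext (ltSMul_ltLiftFil hpq hA hf a ht0 htp)

include hπD in
/-- ★★ **`σ(λ_f(ι_𝒪 x_t)) = a · λ_f(ι_𝒪 x_t)` whenever `σ tₙ = [a]_P(tₙ)` for all `n`** — for the `π`-division tower of the
Lubin–Tate module `F_f` this is `a = χ_π(σ)`. [cite: Colmez1993, §I.2] [cite: FontaineAsterisque223III, Exp. II §1.5.4] -/
theorem gal_ltPeriod (σ : absoluteGaloisGroup F) (a : EisensteinRoot.CoeffDisc D) {t : ℕ → (maxNilIdealC F).toIdeal}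
    (ht0 : (t 0 : CBall F) = 0)
    (htp : ∀ n, ltStepC (EisensteinRoot.CoeffDisc.of D (AdjoinRoot.root D.poly)) (residueFieldCard_ne_zero F) (t (n + 1)) = t n)
    (hσ : ∀ n, AinfTop.galSeq F σ t n = ltSMul (maxNilIdealC F) hA hf a (t n)) :
    BdRPlusTop.gal F p σ (ltPeriod hθ hπ hpq t ht0 htp) =
      algebraMap (FieldCoeff hp hθ) (BdRPlusTop F p) (EisensteinRoot.CoeffDisc.toFieldCoeff D hθ a) * ltPeriod hθ hπ hpq t ht0 htp := by
  rw [gal_ltPeriod_galSeq hpq hπ σ ht0 htp, ← ltPeriod_ltSMul hpq hπ hπD hA hf a ht0 htp]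
  exact ltPeriod_congr hpq hπ (funext hσ) _ _ _ _

end Period

end AinfRamTop

/-! ## §4 The Lubin–Tate period of `F_f`: `t_π := λ_f(ι_𝒪 x_t)` along the `π`-division tower -/

namespace EisensteinRoot

variable (D) {hθ : Function.Surjective (fontaineTheta (integerC F) p)} {π : 𝒪[F]}
  (hπ : (valuation F).IsUniformizer (π : F)) (hπD : (π : F) = D.root) (hpq : p ∣ residueFieldCard F)

variable (hθ) in
/-- **The Lubin–Tate period `t_π := λ_f(ι_𝒪 x_t) ∈ B_dR⁺(F)`** of the `π`-division tower `t = (tₙ)` of `F_f` (`f = πX + X^q`,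
`[π]_f t_{n+1} = tₙ`, `t₁ ≠ 0`), `x_t` Fontaine's element in `A_inf(𝒪)`, `𝒪 = ℤ_p[ϖ] ∋ π`.
[cite: Colmez1993, §I.2] [cite: deShalit1987, Ch. I §1.3] -/
def lubinTatePeriod : BdRPlusTop F p :=
  AinfRamTop.ltPeriod (D := D) hθ hπ hpq (ltDivTower hπ) (coe_ltDivTower_zero hπ) (ltStepC_ltDivTower_succ D hπ hπD)

/-- `t_π ∈ Fil¹ B_dR⁺`. [cite: Colmez1993, §I.2] -/
theorem lubinTatePeriod_mem_filOne : lubinTatePeriod D hθ hπ hπD hpq ∈ (BdRPlusTop.filOne F p).toIdeal :=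
  AinfRamTop.ltPeriod_mem_filOne hpq hπ _ _

/-- ★ **`t_π ∉ Fil² B_dR⁺`** (`q = #k_F ≥ 3`): the Hodge–Tate weight of `χ_π` at the identity embedding is nonzero.
[cite: Colmez1993, §I.2] [cite: Tate1967, §3.3] -/
theorem lubinTatePeriod_not_mem_sq (hq3 : 3 ≤ residueFieldCard F) :
    lubinTatePeriod D hθ hπ hπD hpq ∉ (WithIdeal.i ^ 2 : Ideal (BdRPlusTop F p)) :=
  AinfRamTop.ltPeriod_not_mem_sq hpq hπ hq3 _ _ (ltDivTower_one_ne_zero hπ)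

/-- ★★ **`σ(t_π) = χ_π(σ) · t_π`** for every `σ ∈ Γ_F` whose Lubin–Tate character value `χ_π(σ) ∈ 𝒪_F^×` lies in `𝒪_D`
(`toInt a = χ_π(σ)`; when `F` is totally ramified over `ℚ_p` and `𝒪_D = ℤ_p[π] = 𝒪_F` this is every `σ`).
[cite: Colmez1993, §I.2] [cite: FontaineAsterisque223III, Exp. II §1.5.4] -/
theorem gal_lubinTatePeriod (hA : IsLTRing (CoeffDisc.of D (AdjoinRoot.root D.poly)) (residueFieldCard F))
    (hf : IsLTSeries (CoeffDisc.of D (AdjoinRoot.root D.poly)) (residueFieldCard F)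
      (ltSeries (CoeffDisc.of D (AdjoinRoot.root D.poly)) (residueFieldCard F)))
    (σ : absoluteGaloisGroup F) {a : CoeffDisc D} (ha : CoeffDisc.toInt D a = (lubinTateChar hπ σ : 𝒪[F])) :
    BdRPlusTop.gal F p σ (lubinTatePeriod D hθ hπ hπD hpq) =
      algebraMap (FieldCoeff hp hθ) (BdRPlusTop F p) (FieldCoeff.of hp hθ (((lubinTateChar hπ σ : 𝒪[F]) : F))) *
        lubinTatePeriod D hθ hπ hπD hpq := by
  rw [lubinTatePeriod, AinfRamTop.gal_ltPeriod hpq hπ hπD hA hf σ a _ _ (galSeq_ltDivTower D hπ hπD hA hf σ ha)]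
  congr 2
  change FieldCoeff.of hp hθ (((CoeffDisc.toInt D a : 𝒪[F]) : F)) = _
  rw [ha]

/-- The same law with the scalar written through the Hensel embedding `F ↪ B_dR⁺`.
[cite: Colmez1993, §I.2] [cite: FontaineAsterisque223III, Exp. II §1.5.4] -/
theorem gal_lubinTatePeriod_eq (hA : IsLTRing (CoeffDisc.of D (AdjoinRoot.root D.poly)) (residueFieldCard F))
    (hf : IsLTSeries (CoeffDisc.of D (AdjoinRoot.root D.poly)) (residueFieldCard F)
      (ltSeries (CoeffDisc.of D (AdjoinRoot.root D.poly)) (residueFieldCard F)))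
    (σ : absoluteGaloisGroup F) {a : CoeffDisc D} (ha : CoeffDisc.toInt D a = (lubinTateChar hπ σ : 𝒪[F])) :
    BdRPlusTop.gal F p σ (lubinTatePeriod D hθ hπ hπD hpq) =
      BdRPlusTop.of F p (embBdRHom hp hθ (((lubinTateChar hπ σ : 𝒪[F]) : F))) * lubinTatePeriod D hθ hπ hπD hpq := by
  rw [gal_lubinTatePeriod D hπ hπD hpq hA hf σ ha, FieldCoeff.algebraMap_of]

end EisensteinRoot

end Literature.NumberTheory.PAdicHodge

end
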